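import Summits.NavierStokesRegularity.NavierStokesRegularity.Theorems.ExtremiserTransienceNearExtremalTransienceExtremiserLiouvilleConstantSpeedStokesletDossier
import Summits.NavierStokesRegularity.NavierStokesRegularity.Theorems.ExtremiserTransienceNearExtremalTransienceExtremiserLiouvilleConstantSpeedBarycentreZeroCorollaries
import Summits.NavierStokesRegularity.NavierStokesRegularity.Theorems.ExtremiserTransienceNearExtremalTransienceExtremiserLiouvilleConstantSpeedIsometryTransport
import Summits.NavierStokesRegularity.NavierStokesRegularity.Theorems.ExtremiserTransienceNearExtremalTransienceExtremiserLiouvilleFarFieldLimit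
import HarnessLib

/-!
# Crux `ExtremiserTransience.NearExtremalTransience` (stmt-NavierStokesRegularity-21883), line `extremiser_liouville`,
# stub K1b — AXIAL DOSSIER (g6): K1b ⟸ «no AXIAL flat-or-jet residue object whose multiplier has ZERO BARYCENTRE, EXACT MASS
# `S²/M²`, NO POINT FORCE, and whose blow-down VORTICITY VANISHES»

`--supports stmt-NavierStokesRegularity-21883` (helper).  Author: prover seat `ns-el-k1b` (g6).  The final g6 form of the dossier
chain (`…ConstantSpeedDossier` g2 / `…MultiplierDossier` g3 / `…TailDossier` g4 / `…StokesletDossier` g5 / `…VorticityDossier` g6).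
By the isometry transport (`…ConstantSpeedIsometryTransport`, `R c = ‖c‖e₂`) the residue may be taken in the AXIAL frame
`c = (0,0,c₂)`; there EVERY residue object (flat or jet) carries a finite multiplier measure `μ` with

  (Z) `∫ w dμ = 0` (`…ConstantSpeedBarycentreZero`, g5's law without the jet hypothesis), (M) `M²·μ(ℝ³) = S²`
  (`…BarycentreZeroCorollaries`), (S₀) the Stokeslet law WITHOUT point force `κ⋆²M²W·R⁻²∫⟪w − c', ΔΨ(R⁻¹x)⟫ → 0`,
  (V₀) VANISHING BLOW-DOWN VORTICITY `R⁻¹∫⟪curl w, B(R⁻¹x)⟫ → 0` for every `B ∈ C_c^∞(ℝ³;ℝ³)`,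

besides g2's data (analytic, `C^∞`, divergence free, `‖Dw‖` bounded, `D¹w, D²w ∈ L²`, `‖w‖ ≡ M = ‖c‖ > 0`, `w → c`, `w − c ∈ L⁶`,
`M√Z√W > 0`, `κ⋆M√Z√W = |S|`), the multiplier identity, and g5's flat-or-jet alternative (axial form).
`stub_noAnalyticExtremal_of_noAxialResidueObject`: K1b (conclusion VERBATIM) follows from the non-existence of such an object.
What is left: the loss-of-compactness analysis of the blow-downs `V_R = R(w − c)(R·)` (record `Lines/extremiser_liouville_k1b_jet.md`
§6–§7).  WHAT THIS IS NOT: K1b is NOT proved; nothing here proves NS regularity. [folklore]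
-/

noncomputable section

open Set Filter Topology MeasureTheory Metric Function
open scoped ENNReal NNReal Topology InnerProductSpace RealInnerProductSpace ContDiff Laplacian
open Literature.Analysis.FluidPDE Literature.Analysis

namespace Summit.NavierStokesRegularity.NavierStokesRegularity.Theorems

-- the problem directory repeats the summit name (`NavierStokesRegularity/NavierStokesRegularity`)
set_option linter.dupNamespace false

namespace ExtremiserLiouville

open DepletionLadder.KStar DepletionLadder.KStar.HalfSpace

/-- **AXIAL DOSSIER (g6).**  K1b follows from the non-existence of an axial flat-or-jet residue object `(w, c, M)`,
`c = (0,0,c₂)`, with a KKT multiplier `μ` of zero barycentre and exact mass obeying the point-force-free Stokeslet law and the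
vanishing blow-down vorticity law (all listed properties are THEOREMS about any K1b residue, g2–g6). [folklore] -/
theorem stub_noAnalyticExtremal_of_noAxialResidueObject
    (hres : ∀ (w : E3 → E3) (c : E3) (M : ℝ) (μ : Measure E3),
      AnalyticOnNhd ℝ w Set.univ → ContDiff ℝ (⊤ : ℕ∞) w → VectorCalculus.IsDivFree w →
      (∃ B : ℝ, ∀ x, ‖fderiv ℝ w x‖ ≤ B) → (∫⁻ x, ‖iteratedFDeriv ℝ 1 w x‖ₑ ^ 2 < ⊤) → (∫⁻ x, ‖iteratedFDeriv ℝ 2 w x‖ₑ ^ 2 < ⊤) →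
      (∀ x, ‖w x‖ = M) → 0 < M → c 0 = 0 → c 1 = 0 → c 2 ≠ 0 → ‖c‖ = M →
      Tendsto (fun x => w x - c) (cocompact E3) (𝓝 0) → MemLp (fun x => w x - c) 6 volume →
      0 < M * Real.sqrt (Zen w) * Real.sqrt (Wpa w) → kStar * M * Real.sqrt (Zen w) * Real.sqrt (Wpa w) = |Jst w| →
      -- the multiplier: finite, exact mass, the multiplier equation, zero barycentre
      IsFiniteMeasure μ → M ^ 2 * μ.real univ = Jst w ^ 2 →
      (∀ φ : E3 → E3, ContDiff ℝ ∞ φ → HasCompactSupport φ → VectorCalculus.IsDivFree φ →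
        Jst w * J1 w φ - kStar ^ 2 * M ^ 2 * (Wpa w * A1 w φ + Zen w * C1 w φ) = ∫ x, ⟪w x, φ x⟫_ℝ ∂μ) →
      (∫ x, w x ∂μ) = 0 →
      -- (S₀) the Stokeslet law without point force
      (∀ (c' : E3) (Ψ : E3 → E3), ContDiff ℝ ∞ Ψ → HasCompactSupport Ψ → VectorCalculus.IsDivFree Ψ →
        Tendsto (fun R : ℝ => kStar ^ 2 * M ^ 2 * Wpa w * (R⁻¹ * R⁻¹ * ∫ x, ⟪w x - c', (Δ Ψ) (R⁻¹ • x)⟫_ℝ)) atTop (𝓝 0)) →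
      -- (V₀) the blow-down vorticity vanishes in `𝒟′`
      (∀ B : E3 → E3, ContDiff ℝ ∞ B → HasCompactSupport B →
        Tendsto (fun R : ℝ => R⁻¹ * ∫ x, ⟪curl w x, B (R⁻¹ • x)⟫_ℝ) atTop (𝓝 0)) →
      -- (F/J) the axial flat-or-jet alternative is excluded
      ¬ ((∃ T : ℝ, 0 < T ∧ ¬ Integrable (fun x => {x : E3 | |x 2| ≤ T}.indicator (fun x => ‖w x - c‖ ^ 2) x) volume) ∨
         ((∀ T : ℝ, 0 < T → Integrable (fun x => {x : E3 | |x 2| ≤ T}.indicator (fun x => ‖w x - c‖ ^ 2) x) volume) ∧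
           ∃ E₀ : ℝ, 0 < E₀ ∧ ∀ s : ℝ, (∫ x, deriv Real.smoothTransition (x 2 - s) * ‖w x - c‖ ^ 2) = E₀))) :
    ¬ ∃ (w : EuclideanSpace ℝ (Fin 3) → EuclideanSpace ℝ (Fin 3)), AnalyticOnNhd ℝ w Set.univ ∧ (ContDiff ℝ (⊤ : ℕ∞) w ∧ Literature.Analysis.FluidPDE.VectorCalculus.IsDivFree w ∧ (∃ B : ℝ, ∀ x, ‖fderiv ℝ w x‖ ≤ B) ∧ (∫⁻ x, ‖iteratedFDeriv ℝ 1 w x‖ₑ ^ 2 < ⊤) ∧ (∫⁻ x, ‖iteratedFDeriv ℝ 2 w x‖ₑ ^ 2 < ⊤) ∧ ∃ M : ℝ, (∀ x, ‖w x‖ ≤ M) ∧ 0 < M * Real.sqrt (∫ x, ‖Literature.Analysis.FluidPDE.curl w x‖ ^ 2) * Real.sqrt (∫ x, Literature.Analysis.FluidPDE.frobeniusNormSq (fderiv ℝ (Literature.Analysis.FluidPDE.curl w) x)) ∧ (sInf {κ : ℝ | (∀ (v : EuclideanSpace ℝ (Fin 3) → EuclideanSpace ℝ (Fin 3)) (M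 B : ℝ), ContDiff ℝ (⊤ : ℕ∞) v → Literature.Analysis.FluidPDE.VectorCalculus.IsDivFree v → (∀ x, ‖v x‖ ≤ M) → (∀ x, ‖fderiv ℝ v x‖ ≤ B) → (∫⁻ x, ‖iteratedFDeriv ℝ 0 v x‖ₑ ^ 2 < ⊤) → (∫⁻ x, ‖iteratedFDeriv ℝ 1 v x‖ₑ ^ 2 < ⊤) → (∫⁻ x, ‖iteratedFDeriv ℝ 2 v x‖ₑ ^ 2 < ⊤) → |∫ x, ⟪Literature.Analysis.FluidPDE.curl v x, fderiv ℝ v x (Literature.Analysis.FluidPDE.curl v x)⟫_ℝ| ≤ κ * M * Real.sqrt (∫ x, ‖Literature.Analysis.FluidPDE.curl v x‖ ^ 2) * Real.sqrt (∫ x, Literature.Analysis.FluidPDE.frobeniusNormSq (fderiv ℝ (Literature.Analysis.FluidPDE.curl v) x)))}) * M * Real.sqrt (∫ x, ‖Literature.Analysis.FluidPDE.curl w x‖ ^ 2) * Real.sqrt (∫ x, Literature.Analysis.FluidPDE.frobeniusNormSq (fderiv ℝ (Literature.Analysis.FluidPDE.curl w) x)) ≤ |∫ x, ⟪Literature.Analysis.FluidPDE.curl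 w x, fderiv ℝ w x (Literature.Analysis.FluidPDE.curl w x)⟫_ℝ|) := by
  refine stub_noAnalyticExtremal_of_noJetObject fun w c M han hcd hdiv hB h1 h2 hM hcM hfar hpos heq => ?_
  intro hFJ
  -- `M > 0`, `c ≠ 0`
  have hM0 : 0 ≤ M := (norm_nonneg _).trans (hM 0).le
  have hMpos : 0 < M := by
    rcases hM0.lt_or_eq with h | h
    · exact h
    · rw [← h, zero_mul, zero_mul] at hpos; exact absurd hpos (lt_irrefl 0)
  have hc : c ≠ 0 := by rw [← norm_pos_iff, hcM]; exact hMpos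
  have hcn : ‖c‖ ≠ 0 := norm_ne_zero_iff.2 hc
  obtain ⟨B, hB'⟩ := hB
  -- the axial frame
  obtain ⟨R, hRc, hinner, -⟩ := exists_isometry_to_axis hc
  set e : E3 := ‖c‖ • EuclideanSpace.single (2 : Fin 3) (1 : ℝ) with he
  have he0 : e 0 = 0 := by simp [he]
  have he1 : e 1 = 0 := by simp [he]
  have he2 : e 2 ≠ 0 := by
    have : e 2 = ‖c‖ := by simp [he]
    rw [this]; exact hcn
  set w' : E3 → E3 := fun y => R (w (R.symm y)) with hw'
  obtain ⟨han', hcd', hdiv', hBw', hM', hce, hfar'⟩ := conj_residue_regularity R han hcd hdiv hB' hM hfar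
  rw [hRc] at hfar'
  have heM : ‖e‖ = M := by rw [← hRc, hce, hcM]
  have h1' : ∫⁻ x, ‖iteratedFDeriv ℝ 1 w' x‖ₑ ^ 2 < ⊤ := by rw [hw', lintegral_iteratedFDeriv_conj_eq R 1]; exact h1
  have h2' : ∫⁻ x, ‖iteratedFDeriv ℝ 2 w' x‖ₑ ^ 2 < ⊤ := by rw [hw', lintegral_iteratedFDeriv_conj_eq R 2]; exact h2
  have hZ' : Zen w' = Zen w := Zen_conj R
  have hW' : Wpa w' = Wpa w := Wpa_conj R
  have hS' : Jst w' = Jst w := Jst_conj R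
  have hpos' : 0 < M * Real.sqrt (Zen w') * Real.sqrt (Wpa w') := by rw [hZ', hW']; exact hpos
  have heq' : kStar * M * Real.sqrt (Zen w') * Real.sqrt (Wpa w') = |Jst w'| := by rw [hZ', hW', hS']; exact heq
  -- `w' − e ∈ L⁶` (g2's far-field limit applied to `w'`, uniqueness of the far field)
  have hL6' : MemLp (fun y => w' y - e) 6 volume := by
    have hD : ∫⁻ x, ‖fderiv ℝ w' x‖ₑ ^ 2 < ⊤ := by
      refine lt_of_le_of_lt (le_of_eq (lintegral_congr fun x => ?_)) h1'
      rw [← ofReal_norm, ← ofReal_norm, norm_iteratedFDeriv_one]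
    obtain ⟨c'', -, hfar'', hmem⟩ := exists_farFieldLimit (hcd'.of_le (by norm_cast)) (fun x => (hM' x).le) hBw' hD
    have hce'' : c'' = e := by
      have h : Tendsto (fun y => (w' y - e) - (w' y - c'')) (cocompact E3) (𝓝 (0 - 0)) := hfar'.sub hfar''
      rw [sub_zero] at h
      have h' : Tendsto (fun _ : E3 => c'' - e) (cocompact E3) (𝓝 0) := h.congr fun y => by abel
      have := tendsto_nhds_unique (tendsto_const_nhds (f := (cocompact E3))) h'
      exact sub_eq_zero.1 this
    rw [hce''] at hmem; exact hmem
  -- g3's multiplier for `w'` with g5's Stokeslet law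
  obtain ⟨μ, hfin, hmass, hμ, -⟩ := residue_blowDown_stokeslet hcd' hdiv' hMpos hM' hBw' h1' h2' heq'.symm
  -- the new laws
  have hb : (∫ x, w' x ∂μ) = 0 := integral_barycentre_eq_zero_of_memLp hcd' hdiv' hM' h1' h2' μ hμ he0 he1 he2 heM hL6'
  have hmass' : M ^ 2 * μ.real univ = Jst w' ^ 2 :=
    multiplier_mass_eq hcd' hdiv' hM' hBw' h1' h2' heq'.symm μ hmass hμ he0 he1 he2 heM hL6'
  have hS0 := fun (c' : E3) (Ψ : E3 → E3) (hΨ : ContDiff ℝ ∞ Ψ) (hΨc : HasCompactSupport Ψ) (hΨdiv : VectorCalculus.IsDivFree Ψ) =>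
    tendsto_blowDown_laplacian_pairing_zero hcd' hdiv' hM' h1' h2' μ hμ he0 he1 he2 heM hL6' hΨ hΨc hΨdiv c'
  have hV0 := fun (Bf : E3 → E3) (hBf : ContDiff ℝ ∞ Bf) (hBfc : HasCompactSupport Bf) =>
    tendsto_blowDown_vorticity_zero hcd' hdiv' hM' h1' h2' hpos' μ hμ he0 he1 he2 heM hL6' hBf hBfc
  -- the flat-or-jet alternative in the axial frame
  have hnormV : ∀ y, ‖w' y - e‖ = ‖w (R.symm y) - c‖ := fun y => by
    show ‖R (w (R.symm y)) - e‖ = ‖w (R.symm y) - c‖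
    rw [← hRc, ← map_sub, R.norm_map]
  have hmemS : ∀ (T : ℝ) (y : E3), (y ∈ {x : E3 | |x 2| ≤ T}) ↔ (R.symm y ∈ {x : E3 | |⟪x, c⟫_ℝ| / ‖c‖ ≤ T}) := fun T y => by
    simp only [mem_setOf_eq]
    rw [hinner, abs_mul, abs_of_pos (norm_pos_iff.2 hc), mul_div_cancel_left₀ _ hcn]
  have hslabEq : ∀ T : ℝ, (fun y => {x : E3 | |x 2| ≤ T}.indicator (fun y => ‖w' y - e‖ ^ 2) y) =
      (fun x => {x : E3 | |⟪x, c⟫_ℝ| / ‖c‖ ≤ T}.indicator (fun x => ‖w x - c‖ ^ 2) x) ∘ R.symm := by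
    intro T
    funext y
    simp only [Function.comp]
    by_cases hy : y ∈ {x : E3 | |x 2| ≤ T}
    · rw [indicator_of_mem hy, indicator_of_mem ((hmemS T y).1 hy), hnormV]
    · rw [indicator_of_notMem hy, indicator_of_notMem (fun h => hy ((hmemS T y).2 h))]
  have hslabIff : ∀ T : ℝ, Integrable (fun y => {x : E3 | |x 2| ≤ T}.indicator (fun y => ‖w' y - e‖ ^ 2) y) volume ↔
      Integrable (fun x => {x : E3 | |⟪x, c⟫_ℝ| / ‖c‖ ≤ T}.indicator (fun x => ‖w x - c‖ ^ 2) x) volume := by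
    intro T
    rw [hslabEq T]
    exact R.symm.measurePreserving.integrable_comp_emb R.symm.toHomeomorph.measurableEmbedding
  have hwin : ∀ r : ℝ, (∫ x, deriv Real.smoothTransition (⟪x, c⟫_ℝ / ‖c‖ - r) * ‖w x - c‖ ^ 2) =
      ∫ y, deriv Real.smoothTransition (y 2 - r) * ‖w' y - e‖ ^ 2 := by
    intro r
    rw [← R.symm.measurePreserving.integral_comp R.symm.toHomeomorph.measurableEmbedding
      (fun x => deriv Real.smoothTransition (⟪x, c⟫_ℝ / ‖c‖ - r) * ‖w x - c‖ ^ 2)]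
    congr 1
    funext y
    have hcoord : ⟪R.symm y, c⟫_ℝ / ‖c‖ = y 2 := by rw [hinner]; field_simp
    rw [hcoord, hnormV]
  have hFJ' : (∃ T : ℝ, 0 < T ∧ ¬ Integrable (fun x => {x : E3 | |x 2| ≤ T}.indicator (fun x => ‖w' x - e‖ ^ 2) x) volume) ∨
      ((∀ T : ℝ, 0 < T → Integrable (fun x => {x : E3 | |x 2| ≤ T}.indicator (fun x => ‖w' x - e‖ ^ 2) x) volume) ∧
        ∃ E₀ : ℝ, 0 < E₀ ∧ ∀ s : ℝ, (∫ x, deriv Real.smoothTransition (x 2 - s) * ‖w' x - e‖ ^ 2) = E₀) := by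
    rcases hFJ with ⟨T, hT, hnot⟩ | ⟨hall, E₀, hE₀, hE⟩
    · exact Or.inl ⟨T, hT, fun h => hnot ((hslabIff T).1 h)⟩
    · refine Or.inr ⟨fun T hT => (hslabIff T).2 (hall T hT), E₀, hE₀, fun s => ?_⟩
      rw [← hwin]; exact hE s
  exact hres w' e M μ han' hcd' hdiv' ⟨B, hBw'⟩ h1' h2' hM' hMpos he0 he1 he2 heM hfar' hL6' hpos' heq' hfin hmass' hμ hb
    hS0 hV0 hFJ'

end ExtremiserLiouville

end Summit.NavierStokesRegularity.NavierStokesRegularity.Theorems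

end
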